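import Summits.SmoothPoincare4.SmoothPoincare4.Theorems.ConvexBisectionAcyclicBisectionExistsHgapTwistGlue
import Summits.SmoothPoincare4.SmoothPoincare4.Theorems.ConvexBisectionAcyclicBisectionExistsBeltPageTubeColumn
import HarnessLib

/-!
# Hgap ▸ part B (page twisting of the straightened dual framed knot), brick G2-1 (sphere side):
# the first-order structure of the boundary open book of `X` at the belt circle
(wave 6, crux stmt-SmoothPoincare4-10508, line `modp-braid-orbits`, stub `stub_T3_dualPresentation` (T3)
▸ node `Hgap` ▸ part B `helper_Hgap_twisting`; registered sub-goal `helper_beltSlope_radialDeriv`)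

Let `β♭ = (beltMap D j).boundaryTube` be the belt tube of the `j`-th handle (core = belt circle,
fibre coordinate `m = x_λ ∈ ℝ²`), `Γ m = R₁ (seam (β♭ (θ, m))) ∈ ∂ Base g` its push through the seam
`Ψ` followed by a `w`-rescaling smooth map `R₁` (the time-1 map of the fibred straightening), and
`Θ̂_θ (m) = S_c (w (Γ m))` the PAGE SLOPE of the pushed point (`S_c z = Im (c̄ z)/Re (c̄ z)`,
`…HgapTwistModel.lean`) — the boundary open book of `X` near the belt circle, read through `Ψ` and
straightened, in the chart `β♭`.  This file proves the first-order structure of `Θ̂_θ` at the belt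
circle (`m = 0`):

* §1 `Θ̂_θ` is differentiable at `0` (`differentiableAt_beltSlope`: `β♭`, `seam`, `R₁`, `w` are smooth
  and `Re (c̄ w) = 1/2 ≠ 0` at the flat point `Γ 0`);
* §2 **the radial derivative** (`fderiv_beltSlope_radial`, registered `helper_beltSlope_radialDeriv`):
  for unit `v`, `θ`,
  `dΘ̂_θ (0) · v = 4 ‖dΦ_{K(v)}‖² ⟪D_v θ, n(K(v))⟫`, where `K = (h j).attachingCircle` (in the flat page
  of direction `c`), `D_v = ∂_{m'}|₀ h̄_j (depthLine v m' 0)` is the fibre derivative of the ATTACHING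
  tube at the core point `v`, and `n` the positive page normal: along the ray `r ↦ r v` (`r > 0`) the
  belt tube point is glued to the attaching tube point with EXCHANGED coordinates `(v, r θ)`
  (`pageSlope_seam_belt_eq`, `…HgapTwistGlue.lean`), whose page slope has derivative
  `4 ‖dΦ‖² ⟪D_v θ, n⟫` at `r = 0` (`hasDerivAt_pageSlope_comp`, `…HgapTwistModel.lean`); a one-sided
  derivative of a differentiable function is its derivative.
* §3 **rigidity** (`beltSlope_radial_linear`): consequently `v ↦ 4 ‖dΦ_{K(v)}‖² ⟪D_v θ, n(K(v))⟫` on the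
  unit circle is the restriction of ONE linear functional `ℓ_θ = dΘ̂_θ(0)` of `ℝ²`, and
  `θ ↦ ℓ_θ` is linear in `θ` (`D_v` is linear): `ℓ_θ (v) = ⟪M θ, v⟫` — the matrix `M` of the winding
  count `helper_wind_beltCount` (`…HgapTwistWind.lean`).

Everything is proved; no named facts, no `sorry`.  References: A. A. Kosinski, *Differential
Manifolds* (1993), VI §6 [Kosinski1993]; J. B. Etnyre, T. Fuller, IMRN 2006, Thm. 1 (proof, p. 8)
[EtnyreFuller2006].
-/

noncomputable section

set_option linter.dupNamespace false

open scoped Manifold ContDiff Topology ComplexConjugate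
open Set Function Metric Complex Filter
open Literature.Topology.FourManifolds Literature.Topology.FourManifolds.HandleAttachingMap
  Literature.Topology.FourManifolds.LefschetzBase

namespace Summit.SmoothPoincare4.SmoothPoincare4.Theorems.AcyclicBisectionExists.ModpBraidOrbits

variable {g : ℕ} {ι : Type} [Finite ι] {h : ι → HandleAttachingMap 3 2 (Base g)}
  {X : Type} [TopologicalSpace X] [ChartedSpace (EuclideanHalfSpace 4) X] [IsManifold (𝓡∂ 4) ∞ X]
  (D : MultiAttachmentData h (𝓡∂ 4) X) (bX : BoundaryData (𝓡∂ 4) X (𝓡 3))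
  (Ψ : bX.carrier ≃ₘ⟮𝓡 3, 𝓡 3⟯ (bBase g).carrier)

/-! ## §1 Smoothness of the pushed belt tube and of the attaching tube along the fibres -/

/-- **The pushed belt tube is smooth along the fibre through a core point**: for a smooth
`R₁ : Base g → Base g`, `m ↦ R₁ (seam (β♭ (θ, m)))` read in `ℝ⁴` is `C^∞` at `m = 0`.
[cite: Kosinski1993, VI §6] -/
theorem contDiffAt_beltPushed {R₁ : Base g → Base g} (hR₁ : ContMDiff (𝓡∂ 4) (𝓡∂ 4) ∞ R₁) (j : ι)
    (θ : sphere (0 : EuclideanSpace ℝ (Fin 2)) 1) :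
    ContDiffAt ℝ ∞ (fun m : EuclideanSpace ℝ (Fin 2) =>
      (R₁ ((BoundaryManifold.boundaryData 3 (Base g)).incl (seamDiffeo bX (bBase g) Ψ
        ((beltMap D j).boundaryTube.toHomeo (θ, m))))).1) 0 := by
  have h1 : ContMDiffAt 𝓘(ℝ, EuclideanSpace ℝ (Fin 2)) ((𝓡 1).prod 𝓘(ℝ, EuclideanSpace ℝ (Fin 2))) ∞
      (fun m : EuclideanSpace ℝ (Fin 2) => ((θ, m) : (sphere (0 : EuclideanSpace ℝ (Fin 2)) 1) ×
        EuclideanSpace ℝ (Fin 2))) 0 :=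
    contMDiffAt_const.prodMk contMDiffAt_id
  have h2 : ContMDiffAt ((𝓡 1).prod 𝓘(ℝ, EuclideanSpace ℝ (Fin 2))) (𝓡 3) ∞
      (beltMap D j).boundaryTube.toHomeo ((θ, (0 : EuclideanSpace ℝ (Fin 2))) :
        (sphere (0 : EuclideanSpace ℝ (Fin 2)) 1) × EuclideanSpace ℝ (Fin 2)) :=
    (beltMap D j).boundaryTube.contMDiffAt_toHomeo ((beltMap D j).boundaryTube.mem_source_zero θ)
  have h3 : ContMDiff (𝓡 3) (𝓡∂ 4) ∞ (fun y => (BoundaryManifold.boundaryData 3 (Base g)).incl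
      (seamDiffeo bX (bBase g) Ψ y)) :=
    (BoundaryManifold.boundaryData 3 (Base g)).isSmoothEmbedding.contMDiff.comp
      (seamDiffeo bX (bBase g) Ψ).contMDiff
  have h4 : ContMDiff (𝓡∂ 4) 𝓘(ℝ, EuclideanSpace ℝ (Fin 4)) ∞ (fun x : Base g => (R₁ x).1) :=
    (RegularSublevel.contMDiff_incl (isRegularLevel_rho g)).comp hR₁
  have h := ((h4.comp h3).contMDiffAt.comp _ h2).comp 0 h1
  exact contMDiffAt_iff_contDiffAt.1 h

/-- **The attaching tube is smooth along the fibre through a core point**: `m' ↦ h̄_j (depthLine v m' 0)`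
read in `ℝ⁴` is `C^∞` at `m' = 0`, with value the core point `K(v)` there. [cite: Kosinski1993, VI §6] -/
theorem contDiffAt_attachingFibre (f : HandleAttachingMap 3 2 (Base g))
    (v : sphere (0 : EuclideanSpace ℝ (Fin 2)) 1) :
    ContDiffAt ℝ ∞ (fun m' : EuclideanSpace ℝ (Fin 2) => (f.toFun (depthLine v m' 0)).1) 0 := by
  have h1 : ContMDiffAt 𝓘(ℝ, EuclideanSpace ℝ (Fin 2)) ((𝓡 1).prod 𝓘(ℝ, EuclideanSpace ℝ (Fin 2))) ∞
      (fun m : EuclideanSpace ℝ (Fin 2) => ((v, m) : (sphere (0 : EuclideanSpace ℝ (Fin 2)) 1) ×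
        EuclideanSpace ℝ (Fin 2))) 0 :=
    contMDiffAt_const.prodMk contMDiffAt_id
  have h2 := contMDiffAt_coe_tube (g := g) f.boundaryTube (f.boundaryTube.mem_source_zero v)
  have h := h2.comp 0 h1
  exact contMDiffAt_iff_contDiffAt.1 h

/-- The page slope is differentiable at a point where `Re (c̄ w) ≠ 0`, for a differentiable map.
[folklore] -/
theorem differentiableAt_pageSlope_comp {E : Type*} [NormedAddCommGroup E] [NormedSpace ℝ E]
    {F : E → EuclideanSpace ℝ (Fin 4)} {m₀ : E} (hF : DifferentiableAt ℝ F m₀) (c : ℂ)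
    (hre : (conj c * w g (F m₀)).re ≠ 0) :
    DifferentiableAt ℝ (fun m => (conj c * w g (F m)).im / (conj c * w g (F m)).re) m₀ := by
  have hW : DifferentiableAt ℝ (fun m => conj c * w g (F m)) m₀ :=
    ((((contDiff_w g).differentiable (by simp)) (F m₀)).comp m₀ hF).const_mul (conj c)
  have hRe : DifferentiableAt ℝ (fun m => (conj c * w g (F m)).re) m₀ := Complex.reCLM.differentiableAt.comp m₀ hW
  have hIm : DifferentiableAt ℝ (fun m => (conj c * w g (F m)).im) m₀ := Complex.imCLM.differentiableAt.comp m₀ hW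
  have hInv : DifferentiableAt ℝ (fun m => ((conj c * w g (F m)).re)⁻¹) m₀ := hRe.fun_inv hre
  have h := hIm.mul hInv
  have e : (fun m => (conj c * w g (F m)).im / (conj c * w g (F m)).re) =
      fun m => (conj c * w g (F m)).im * ((conj c * w g (F m)).re)⁻¹ := by
    funext m; rw [div_eq_mul_inv]
  rw [e]; exact h

/-! ## §2 The radial derivative of the belt slope -/

/-- **The radial derivative of the page slope along the pushed belt tube** (brick G2-1, sphere side).
Let `(D, bX, Ψ)` be a fibred model with the page clause, `h̄_j` with attaching circle `K` in the flat
page of direction `c`, `R₁` a smooth `w`-rescaling self-map of `Base g`, and `θ` a point of the belt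
circle whose pushed straightened image `Γ 0 = R₁ (seam (β♭ (θ, 0)))` is flat of direction `c`
(`w = c/2`).  Then for every unit `v` the derivative of the page slope `Θ̂_θ (m) = S_c (w (Γ m))` at
`m = 0` in the direction `v` is `4 ‖dΦ_{K(v)}‖² ⟪D_v θ, n(K(v))⟫`, `D_v` the fibre derivative of the
attaching tube at the core point `v`. [cite: EtnyreFuller2006, Thm. 1 (proof, p. 8)] -/
theorem fderiv_beltSlope_radial
    (hpage : ∀ (y : bX.carrier) (a : ↥(coresComplement h)), bX.incl y = D.jA a →
      ∃ c : ℝ, 0 < c ∧ w g ((bBase g).incl (Ψ y)).1 = (c : ℂ) * w g (a : Base g).1)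
    (j : ι) {c : ℂ} (hc : ‖c‖ = 1) (hKc : ∀ v, (h j).attachingCircle v ∈ page g c)
    {R₁ : Base g → Base g} (hR₁ : ContMDiff (𝓡∂ 4) (𝓡∂ 4) ∞ R₁)
    (hRw : ∀ x : Base g, ∃ t : ℝ, 0 < t ∧ w g (R₁ x).1 = (t : ℂ) * w g x.1)
    (θ v : sphere (0 : EuclideanSpace ℝ (Fin 2)) 1)
    (hflat : w g (R₁ ((BoundaryManifold.boundaryData 3 (Base g)).incl (seamDiffeo bX (bBase g) Ψ
      ((beltMap D j).boundaryTube.toHomeo (θ, (0 : EuclideanSpace ℝ (Fin 2))))))).1 = c / 2) :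
    fderiv ℝ (fun m : EuclideanSpace ℝ (Fin 2) =>
        (conj c * w g (R₁ ((BoundaryManifold.boundaryData 3 (Base g)).incl (seamDiffeo bX (bBase g) Ψ
          ((beltMap D j).boundaryTube.toHomeo (θ, m))))).1).im /
        (conj c * w g (R₁ ((BoundaryManifold.boundaryData 3 (Base g)).incl (seamDiffeo bX (bBase g) Ψ
          ((beltMap D j).boundaryTube.toHomeo (θ, m))))).1).re) 0 (v : EuclideanSpace ℝ (Fin 2)) =
      4 * (‖dPhiX g ((h j).attachingCircle v).1‖ ^ 2 + ‖dPhiY ((h j).attachingCircle v).1‖ ^ 2) *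
        inner ℝ (fderiv ℝ (fun m' : EuclideanSpace ℝ (Fin 2) => ((h j).toFun (depthLine v m' 0)).1) 0
          (θ : EuclideanSpace ℝ (Fin 2))) (horizNormal g ((h j).attachingCircle v).1) := by
  -- the pushed map `Γ` read in `ℝ⁴` and the slope `Θ̂`
  set Γ : EuclideanSpace ℝ (Fin 2) → EuclideanSpace ℝ (Fin 4) := fun m =>
    (R₁ ((BoundaryManifold.boundaryData 3 (Base g)).incl (seamDiffeo bX (bBase g) Ψ
      ((beltMap D j).boundaryTube.toHomeo (θ, m))))).1 with hΓ
  set Th : EuclideanSpace ℝ (Fin 2) → ℝ := fun m => (conj c * w g (Γ m)).im / (conj c * w g (Γ m)).re with hTh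
  have hΓd : DifferentiableAt ℝ Γ 0 := (contDiffAt_beltPushed D bX Ψ hR₁ j θ).differentiableAt (by simp)
  have hw0 : w g (Γ 0) = c / 2 := hflat
  have hre0 : (conj c * w g (Γ 0)).re ≠ 0 := by
    rw [hw0, (conj_mul_half_self hc).1]; norm_num
  have hThd : DifferentiableAt ℝ Th 0 := differentiableAt_pageSlope_comp hΓd c hre0
  -- (a) along the ray `r ↦ r v`: the two-sided derivative of `Θ̂`
  have hray : HasDerivAt (fun r : ℝ => Th (r • (v : EuclideanSpace ℝ (Fin 2))))
      (fderiv ℝ Th 0 (v : EuclideanSpace ℝ (Fin 2))) 0 := by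
    have hl : HasDerivAt (fun r : ℝ => r • (v : EuclideanSpace ℝ (Fin 2))) (v : EuclideanSpace ℝ (Fin 2)) 0 := by
      simpa using (hasDerivAt_id (0 : ℝ)).smul_const (v : EuclideanSpace ℝ (Fin 2))
    exact hThd.hasFDerivAt.comp_hasDerivAt_of_eq (0 : ℝ) hl (by simp)
  -- (b) the attaching-tube side: the radial arc and its page slope
  set F : EuclideanSpace ℝ (Fin 2) → EuclideanSpace ℝ (Fin 4) := fun m' => ((h j).toFun (depthLine v m' 0)).1 with hF
  have hFd : DifferentiableAt ℝ F 0 := (contDiffAt_attachingFibre (h j) v).differentiableAt (by simp)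
  have hF0 : F 0 = ((h j).attachingCircle v).1 := by
    show ((h j).toFun (depthLine v 0 0)).1 = _
    rw [depthLine_zero_zero]; rfl
  have hwF : w g (F ((0 : ℝ) • (θ : EuclideanSpace ℝ (Fin 2)))) = c / 2 := by
    rw [zero_smul, hF0]; exact (hKc v).2
  have harc : HasDerivAt (fun r : ℝ => F (r • (θ : EuclideanSpace ℝ (Fin 2))))
      (fderiv ℝ F 0 (θ : EuclideanSpace ℝ (Fin 2))) 0 := by
    have hl : HasDerivAt (fun r : ℝ => r • (θ : EuclideanSpace ℝ (Fin 2))) (θ : EuclideanSpace ℝ (Fin 2)) 0 := by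
      simpa using (hasDerivAt_id (0 : ℝ)).smul_const (θ : EuclideanSpace ℝ (Fin 2))
    exact hFd.hasFDerivAt.comp_hasDerivAt_of_eq (0 : ℝ) hl (by simp)
  have hT := hasDerivAt_pageSlope_comp (g := g) harc hc hwF
  rw [zero_smul, hF0] at hT
  -- (c) the two slopes agree on `(0, 1)` and at `0`
  have hagree : ∀ r ∈ Ioo (0 : ℝ) 1, Th (r • (v : EuclideanSpace ℝ (Fin 2))) =
      (conj c * w g (F (r • (θ : EuclideanSpace ℝ (Fin 2))))).im /
        (conj c * w g (F (r • (θ : EuclideanSpace ℝ (Fin 2))))).re := fun r hr =>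
    pageSlope_seam_belt_eq D bX Ψ hpage hRw c j v θ hr.1 hr.2
  have h0eq : Th ((0 : ℝ) • (v : EuclideanSpace ℝ (Fin 2))) =
      (conj c * w g (F ((0 : ℝ) • (θ : EuclideanSpace ℝ (Fin 2))))).im /
        (conj c * w g (F ((0 : ℝ) • (θ : EuclideanSpace ℝ (Fin 2))))).re := by
    rw [zero_smul, zero_smul, hF0]
    show (conj c * w g (Γ 0)).im / (conj c * w g (Γ 0)).re = _
    rw [hw0, (hKc v).2]
  -- (d) one-sided uniqueness on `(0, ∞)`
  have hW1 : HasDerivWithinAt (fun r : ℝ => Th (r • (v : EuclideanSpace ℝ (Fin 2))))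
      (fderiv ℝ Th 0 (v : EuclideanSpace ℝ (Fin 2))) (Ioi 0) 0 := hray.hasDerivWithinAt
  have hW2 : HasDerivWithinAt (fun r : ℝ => Th (r • (v : EuclideanSpace ℝ (Fin 2))))
      (4 * (‖dPhiX g ((h j).attachingCircle v).1‖ ^ 2 + ‖dPhiY ((h j).attachingCircle v).1‖ ^ 2) *
        inner ℝ (fderiv ℝ F 0 (θ : EuclideanSpace ℝ (Fin 2))) (horizNormal g ((h j).attachingCircle v).1))
      (Ioi 0) 0 := by
    refine hT.hasDerivWithinAt.congr_of_eventuallyEq ?_ h0eq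
    have hmem : Ioo (0 : ℝ) 1 ∈ 𝓝[Ioi (0 : ℝ)] 0 := Ioo_mem_nhdsGT one_pos
    filter_upwards [hmem] with r hr
    exact hagree r hr
  have e1 := hW1.derivWithin (uniqueDiffWithinAt_Ioi 0)
  have e2 := hW2.derivWithin (uniqueDiffWithinAt_Ioi 0)
  exact e1.symm.trans e2

/-- **Sub-goal `helper_beltSlope_radialDeriv` of stub `stub_T3_dualPresentation`** (T3 ▸ node `Hgap` ▸
part B `helper_Hgap_twisting`, brick G2-1 sphere side; wave 6, lead c5): the radial derivative of the
page slope of the pushed, straightened belt tube at a belt-circle point `θ` in a unit direction `v` is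
`4 ‖dΦ_{K(v)}‖² ⟪D_v θ, n(K(v))⟫`. [cite: EtnyreFuller2006, Thm. 1 (proof, p. 8)] -/
theorem helper_beltSlope_radialDeriv : ∀ (g : ℕ) (ι : Type) [Finite ι] (h : ι → Literature.Topology.FourManifolds.HandleAttachingMap 3 2 (Literature.Topology.FourManifolds.LefschetzBase.Base g)) (X : Type) [TopologicalSpace X] [ChartedSpace (EuclideanHalfSpace 4) X] [IsManifold (𝓡∂ 4) ∞ X] (D : Literature.Topology.FourManifolds.HandleAttachingMap.MultiAttachmentData h (𝓡∂ 4) X) (bX : Literature.Topology.FourManifolds.BoundaryData (𝓡∂ 4) X (𝓡 3)) (Ψ : bX.carrier ≃ₘ⟮𝓡 3, 𝓡 3⟯ (Literature.Topology.FourManifolds.LefschetzBase.bBase g).carrier), (∀ (y : bX.carrier) (a : ↥(Literature.Topology.FourManifolds.HandleAttachingMap.coresComplement h)), bX.incl y = D.jA a → ∃ c : ℝ, 0 < c ∧ Literature.Topology.FourManifolds.LefschetzBase.w g ((Literature.Topology.FourManifolds.LefschetzBase.bBase g).incl (Ψ y)).1 = (c : ℂ) * Literature.Topology.FourManifolds.LefschetzBase.w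 g (a : Literature.Topology.FourManifolds.LefschetzBase.Base g).1) → ∀ (j : ι) (c : ℂ), ‖c‖ = 1 → (∀ v, (h j).attachingCircle v ∈ Literature.Topology.FourManifolds.LefschetzBase.page g c) → ∀ (R₁ : Literature.Topology.FourManifolds.LefschetzBase.Base g → Literature.Topology.FourManifolds.LefschetzBase.Base g), ContMDiff (𝓡∂ 4) (𝓡∂ 4) ∞ R₁ → (∀ x : Literature.Topology.FourManifolds.LefschetzBase.Base g, ∃ t : ℝ, 0 < t ∧ Literature.Topology.FourManifolds.LefschetzBase.w g (R₁ x).1 = (t : ℂ) * Literature.Topology.FourManifolds.LefschetzBase.w g x.1) → ∀ (θ v : Metric.sphere (0 : EuclideanSpace ℝ (Fin 2)) 1), Literature.Topology.FourManifolds.LefschetzBase.w g (R₁ ((Literature.Topology.FourManifolds.BoundaryManifold.boundaryData 3 (Literature.Topology.FourManifolds.LefschetzBase.Base g)).incl (Summit.SmoothPoincare4.SmoothPoincare4.Theorems.AcyclicBisectionExists.ModpBraidOrbits.seamDiffeo bX (Literature.Topology.FourManifolds.LefschetzBase.bBase g) Ψ ((Summit.SmoothPoincare4.SmoothPoincare4.Theorems.AcyclicBisectionExists.ModpBraidOrbits.beltMap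 D j).boundaryTube.toHomeo (θ, (0 : EuclideanSpace ℝ (Fin 2))))))).1 = c / 2 → fderiv ℝ (fun m : EuclideanSpace ℝ (Fin 2) => ((starRingEnd ℂ) c * Literature.Topology.FourManifolds.LefschetzBase.w g (R₁ ((Literature.Topology.FourManifolds.BoundaryManifold.boundaryData 3 (Literature.Topology.FourManifolds.LefschetzBase.Base g)).incl (Summit.SmoothPoincare4.SmoothPoincare4.Theorems.AcyclicBisectionExists.ModpBraidOrbits.seamDiffeo bX (Literature.Topology.FourManifolds.LefschetzBase.bBase g) Ψ ((Summit.SmoothPoincare4.SmoothPoincare4.Theorems.AcyclicBisectionExists.ModpBraidOrbits.beltMap D j).boundaryTube.toHomeo (θ, m))))).1).im / ((starRingEnd ℂ) c * Literature.Topology.FourManifolds.LefschetzBase.w g (R₁ ((Literature.Topology.FourManifolds.BoundaryManifold.boundaryData 3 (Literature.Topology.FourManifolds.LefschetzBase.Base g)).incl (Summit.SmoothPoincare4.SmoothPoincare4.Theorems.AcyclicBisectionExists.ModpBraidOrbits.seamDiffeo bX (Literature.Topology.FourManifolds.LefschetzBase.bBase g) Ψ ((Summit.SmoothPoincare4.SmoothPoincare4.Theorems.AcyclicBisectionExists.ModpBraidOrbits.beltMap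 D j).boundaryTube.toHomeo (θ, m))))).1).re) 0 (v : EuclideanSpace ℝ (Fin 2)) = 4 * (‖Literature.Topology.FourManifolds.LefschetzBase.dPhiX g ((h j).attachingCircle v).1‖ ^ 2 + ‖Literature.Topology.FourManifolds.LefschetzBase.dPhiY ((h j).attachingCircle v).1‖ ^ 2) * inner ℝ (fderiv ℝ (fun m' : EuclideanSpace ℝ (Fin 2) => ((h j).toFun (Literature.Topology.FourManifolds.depthLine v m' 0)).1) 0 (θ : EuclideanSpace ℝ (Fin 2))) (Literature.Topology.FourManifolds.LefschetzBase.horizNormal g ((h j).attachingCircle v).1) :=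
  fun _ _ _ _ _ _ _ _ D bX Ψ hpage j _ hc hKc _ hR₁ hRw θ v hflat =>
    fderiv_beltSlope_radial D bX Ψ hpage j hc hKc hR₁ hRw θ v hflat

/-! ## §3 Rigidity: the radial derivatives assemble into one bilinear form -/

/-- **The radial derivatives are the values of ONE linear functional** (rigidity of fibred witnesses):
under the hypotheses of `fderiv_beltSlope_radial` there is `ℓ : ℝ² →L ℝ` (namely `dΘ̂_θ (0)`) with
`ℓ v = 4 ‖dΦ_{K(v)}‖² ⟪D_v θ, n(K(v))⟫` for EVERY unit `v` — the normal components of the fibre frame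
of the attaching tube, rescaled by the page metric, vary linearly around the core.
[cite: EtnyreFuller2006, Thm. 1 (proof, p. 8)] -/
theorem beltSlope_radial_linear
    (hpage : ∀ (y : bX.carrier) (a : ↥(coresComplement h)), bX.incl y = D.jA a →
      ∃ c : ℝ, 0 < c ∧ w g ((bBase g).incl (Ψ y)).1 = (c : ℂ) * w g (a : Base g).1)
    (j : ι) {c : ℂ} (hc : ‖c‖ = 1) (hKc : ∀ v, (h j).attachingCircle v ∈ page g c)
    {R₁ : Base g → Base g} (hR₁ : ContMDiff (𝓡∂ 4) (𝓡∂ 4) ∞ R₁)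
    (hRw : ∀ x : Base g, ∃ t : ℝ, 0 < t ∧ w g (R₁ x).1 = (t : ℂ) * w g x.1)
    (θ : sphere (0 : EuclideanSpace ℝ (Fin 2)) 1)
    (hflat : w g (R₁ ((BoundaryManifold.boundaryData 3 (Base g)).incl (seamDiffeo bX (bBase g) Ψ
      ((beltMap D j).boundaryTube.toHomeo (θ, (0 : EuclideanSpace ℝ (Fin 2))))))).1 = c / 2) :
    ∃ ℓ : EuclideanSpace ℝ (Fin 2) →L[ℝ] ℝ, ∀ v : sphere (0 : EuclideanSpace ℝ (Fin 2)) 1,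
      ℓ (v : EuclideanSpace ℝ (Fin 2)) =
        4 * (‖dPhiX g ((h j).attachingCircle v).1‖ ^ 2 + ‖dPhiY ((h j).attachingCircle v).1‖ ^ 2) *
          inner ℝ (fderiv ℝ (fun m' : EuclideanSpace ℝ (Fin 2) => ((h j).toFun (depthLine v m' 0)).1) 0
            (θ : EuclideanSpace ℝ (Fin 2))) (horizNormal g ((h j).attachingCircle v).1) :=
  ⟨_, fun v => fderiv_beltSlope_radial D bX Ψ hpage j hc hKc hR₁ hRw θ v hflat⟩

end Summit.SmoothPoincare4.SmoothPoincare4.Theorems.AcyclicBisectionExists.ModpBraidOrbits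

end
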